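import Literature.Geometry.Kaehler.ComplexTorusKunnethDiagonalDivisorFormula
import HarnessLib

/-!
# The graph class of a homomorphism into a polarised complex torus is an explicit divisor polynomial
# (Milne 1999, Thm. 5.10: "`(φ × id)^*(Δ_B) = Δ_B ∘ Γ_φ = Γ_φ` … shows that `Γ_φ` is also Lefschetz", torus level)

Layer `Literature/Geometry/Kaehler`, namespace `Literature.Geometry.Kaehler.ComplexTorus`; lane `lit-hodgefound`
(Track 2 foundations library), Layer A4, prover seat `lit-hodgefound-p08` (generation 11; FILE 3 of row g11-#1 = Q1166
«Milne 1999 Thm. 5.10 (proof display) + Rem. 5.11 … read in cohomology at torus level»). Sequel, BY NAME, of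
`ComplexTorusKunnethDiagonalDivisorFormula` (Q1166: `Σ_{i ≤ 2g} p_i = of (2g) [Δ_X]` in the graded ring `GForm`,
`IsRiemannForm.sum_schollProjector_eq_of_cycleForm_diagonal`; `pullG` is a ring map, `pullG_mul`, `pullG_pow`) and of
`ComplexTorusGraphClassesLefschetz` (g7-#1: Fulton's `[Γ_f] = (f × 1)^*[Δ_{X₂}]`,
`SubtorusFrame.cycleForm_graph_eq_cycleForm_diagonal_comp_realRep`; `realRep_fromBlocks_one_apply`;
`analyticRep_restrictScalars`).

## Source, verbatim

J. S. Milne, *Lefschetz classes on abelian varieties*, Duke Math. J. **96** (1999) 639–675, held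
`paper:doi-10-1215-s0012-7094-99-09620-5`, p. 665 (p0027 L16–L48): "**Theorem 5.10.** For every adequate equivalence
relation, the graph of a regular map of abelian varieties `φ : A → B` is a Lefschetz class on `A × B`. *Proof.* …
`p_i = ((−1)ⁱ/deg(λ_D)) Σ_{max(0,i−g) ≤ j ≤ i/2} (1/(j!(g−i+j)!(i−2j)!)) p^*([D^{g−i+j}]) · q^*([Dʲ]) · [M]^{i−2j}` …
`p₀ + p₁ + ⋯ + p_{2g} = Δ_A` … Clearly each `p_i` is Lefschetz, and so `Δ_A` is Lefschetz. Similarly `Δ_B` is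
Lefschetz, and so the formula `(φ × id)^*(Δ_B) = Δ_B ∘ Γ_φ = Γ_φ` (Fulton 1984, 16.1.1) shows that `Γ_φ` is also
Lefschetz."

## What is proved (torus level; theorems only, no definitions, no named facts)

For complex tori `X₁ = E₁/Φ₁(ℤ^{ι₁})`, `X₂ = E₂/Φ₂(ℤ^{ι₂})`, a homomorphism `f : X₁ → X₂` with analytic representation
`L : E₁ →L[ℂ] E₂` and rational representation `A` (`hA`), `X₂` polarised of dimension `g` and type `(d₁, …, d_g)`
(`hη : IsRiemannForm Φ₂ η`, `hd`, `ω = c₁(L) = ofRealForm (-η)`), the graph `Γ_f ⊂ X₁ × X₂` (p08's datum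
`SubtorusFrame.graph`, `e₁` positively oriented, `e` any enumeration of `Λ₁ ⊕ Λ₂`):
* **`IsRiemannForm.of_cycleForm_graph_eq_sum`**: in the graded ring of invariant forms on `X₁ × X₂`,
  `of (2g) [Γ_f] = Σ_{i ≤ 2g} ((-1)ⁱ/(d₁⋯d_g)) Σ_j (1/(j!(g-i+j)!(i-2j)!)) (of 2 p₁^*f^*ω)^{g-i+j} (of 2 p₂^*ω)^j (of 2 μ_f)^{i-2j}`
  with `μ_f := (f × 1)^*μ = ω ∘ (f p₁ + p₂) − ω ∘ (f p₁) − ω ∘ p₂` (`= c₁((f × 1)^*Λ(L))`) — Milne's display pulled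
  back along `f × 1`: THE GRAPH CLASS IS AN EXPLICIT POLYNOMIAL IN THE THREE DIVISOR CLASSES `p₁^*f^*ω`, `p₂^*ω`,
  `μ_f` of `X₁ × X₂`;
* the three pull-back identities `compContinuousLinearMap_fst_realRep_fromBlocks_one`,
  `compContinuousLinearMap_snd_realRep_fromBlocks_one`, `mixedForm_compContinuousLinearMap_realRep_fromBlocks_one`
  (`(f × 1)^*p₁^*θ = p₁^*f^*θ`, `(f × 1)^*p₂^*θ = p₂^*θ`, `(f × 1)^*μ = μ_f`).

NOT here: Chow groups (Milne's statement is for every adequate equivalence relation; this is its image in cohomology);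
membership `[Γ_f] ∈ D(X₁ × X₂)` is g7-#1 `SubtorusFrame.cycleForm_graph_mem_divisorClasses`.

## References

* [Milne1999LefschetzClasses] J. S. Milne, *Lefschetz classes on abelian varieties*, Duke Math. J. 96 (1999), §5
  Thm. 5.10 (statement and proof, p. 665).
* [Fulton1998] W. Fulton, *Intersection Theory*, 2nd ed. (1998), Prop. 16.1.1 (c)(ii).
* [Lange2023AbelianVarietiesComplex] H. Lange, *Abelian Varieties over the Complex Numbers* (2023), §6.2.2 Prop. 6.2.10.
-/

noncomputable section

open scoped Manifold ContDiff Topology Real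
open Set Function Complex Finset Module
open Literature.LinearAlgebra.Alternating
open Literature.LinearAlgebra.Alternating.GForm (of pullG IsHomog)

namespace Literature.Geometry.Kaehler

namespace ComplexTorus

section GraphFormula

variable {ι₁ ι₂ : Type*} [Fintype ι₁] [Fintype ι₂] [DecidableEq ι₁] [DecidableEq ι₂]
  {E₁ E₂ : Type*} [NormedAddCommGroup E₁] [NormedSpace ℂ E₁] [NormedAddCommGroup E₂] [NormedSpace ℂ E₂]
  (Φ₁ : (ι₁ → ℝ) ≃L[ℝ] E₁) (Φ₂ : (ι₂ → ℝ) ≃L[ℝ] E₂) {N₁ g : ℕ}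
  (e₁ : Fin N₁ ≃ ι₁) (he₁ : orientationSign Φ₁ e₁ = 1) (e₂ : Fin (2 * g) ≃ ι₂)
  {L : E₁ →L[ℂ] E₂} {A : Matrix ι₂ ι₁ ℤ} (hA : ∀ x : ι₁ → ℝ, Φ₂ ((A.map (Int.cast : ℤ → ℝ)).mulVec x) = L (Φ₁ x))

omit [Fintype ι₁] [Fintype ι₂] [DecidableEq ι₁] [DecidableEq ι₂] in
/-- `(θ ∘ T) ∘ S = θ ∘ (T ∘ S)`. [folklore] -/
private theorem compCLM_compCLM'' {V W W' : Type*} [NormedAddCommGroup V] [NormedSpace ℝ V] [NormedAddCommGroup W]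
    [NormedSpace ℝ W] [NormedAddCommGroup W'] [NormedSpace ℝ W'] {k : ℕ} (θ : V [⋀^Fin k]→L[ℝ] ℂ)
    (T : W →L[ℝ] V) (S : W' →L[ℝ] W) :
    (θ.compContinuousLinearMap T).compContinuousLinearMap S = θ.compContinuousLinearMap (T.comp S) := by
  ext v; rfl

omit [Fintype ι₁] [Fintype ι₂] [DecidableEq ι₁] [DecidableEq ι₂] in
/-- `(θ − θ' − θ'') ∘ S = θ ∘ S − θ' ∘ S − θ'' ∘ S`. [folklore] -/
private theorem sub_sub_compCLM {V W : Type*} [NormedAddCommGroup V] [NormedSpace ℝ V] [NormedAddCommGroup W]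
    [NormedSpace ℝ W] {k : ℕ} (θ θ' θ'' : V [⋀^Fin k]→L[ℝ] ℂ) (S : W →L[ℝ] V) :
    (θ - θ' - θ'').compContinuousLinearMap S =
      θ.compContinuousLinearMap S - θ'.compContinuousLinearMap S - θ''.compContinuousLinearMap S := by
  ext v; rfl

include hA in
omit [DecidableEq ι₁] in
/-- `p₁ ∘ (f × 1) = f ∘ p₁` on `X₁ × X₂` (analytic representations). [cite: Lange2023AbelianVarietiesComplex, §6.2.2 Prop. 6.2.10] -/
theorem fst_comp_realRep_fromBlocks_one :
    (ContinuousLinearMap.fst ℝ E₂ E₂).comp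
        (realRep (prodPeriod Φ₁ Φ₂) (prodPeriod Φ₂ Φ₂) (Matrix.fromBlocks A 0 0 (1 : Matrix ι₂ ι₂ ℤ))) =
      (L.restrictScalars ℝ).comp (ContinuousLinearMap.fst ℝ E₁ E₂) := by
  refine ContinuousLinearMap.ext fun w ↦ ?_
  rw [ContinuousLinearMap.comp_apply, realRep_fromBlocks_one_apply, ← analyticRep_restrictScalars hA]
  rfl

omit [DecidableEq ι₁] in
/-- `p₂ ∘ (f × 1) = p₂` on `X₁ × X₂`. [cite: Lange2023AbelianVarietiesComplex, §6.2.2 Prop. 6.2.10] -/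
theorem snd_comp_realRep_fromBlocks_one :
    (ContinuousLinearMap.snd ℝ E₂ E₂).comp
        (realRep (prodPeriod Φ₁ Φ₂) (prodPeriod Φ₂ Φ₂) (Matrix.fromBlocks A 0 0 (1 : Matrix ι₂ ι₂ ℤ))) =
      ContinuousLinearMap.snd ℝ E₁ E₂ := by
  refine ContinuousLinearMap.ext fun w ↦ ?_
  rw [ContinuousLinearMap.comp_apply, realRep_fromBlocks_one_apply]
  rfl

include hA in
omit [DecidableEq ι₁] in
/-- `m ∘ (f × 1) = f ∘ p₁ + p₂` on `X₁ × X₂` (`m = p₁ + p₂` the addition of `X₂`). [cite: Lange2023AbelianVarietiesComplex, §6.2.2 Prop. 6.2.10] -/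
theorem fst_add_snd_comp_realRep_fromBlocks_one :
    (ContinuousLinearMap.fst ℝ E₂ E₂ + ContinuousLinearMap.snd ℝ E₂ E₂).comp
        (realRep (prodPeriod Φ₁ Φ₂) (prodPeriod Φ₂ Φ₂) (Matrix.fromBlocks A 0 0 (1 : Matrix ι₂ ι₂ ℤ))) =
      (L.restrictScalars ℝ).comp (ContinuousLinearMap.fst ℝ E₁ E₂) + ContinuousLinearMap.snd ℝ E₁ E₂ := by
  rw [ContinuousLinearMap.add_comp, fst_comp_realRep_fromBlocks_one Φ₁ Φ₂ hA, snd_comp_realRep_fromBlocks_one]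

variable {η : E₂ [⋀^Fin 2]→L[ℝ] ℝ}

include e₂ hA in
/-- **THEOREM (Milne 1999, Thm. 5.10, the graph of a homomorphism, EXPLICITLY, at torus level).** For a homomorphism
`f : X₁ → X₂` of complex tori into a polarised torus `X₂` of dimension `g` and type `(d₁, …, d_g)` (`ω = c₁(L)`), the
class of the graph `Γ_f ⊂ X₁ × X₂` is, in the graded ring of invariant forms on `X₁ × X₂`, the pull-back along
`f × 1` of Scholl's `p₀ + ⋯ + p_{2g} = Δ_{X₂}`:
`of (2g) [Γ_f] = Σ_{i ≤ 2g} ((-1)ⁱ/(d₁⋯d_g)) Σ_{max(0,i-g) ≤ j ≤ i/2} (1/(j!(g-i+j)!(i-2j)!)) (of 2 p₁^*f^*ω)^{g-i+j} (of 2 p₂^*ω)^j (of 2 μ_f)^{i-2j}`,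
`μ_f = ω ∘ (f p₁ + p₂) − ω ∘ (f p₁) − ω ∘ p₂` — an explicit polynomial in three divisor classes of `X₁ × X₂`
("`(φ × id)^*(Δ_B) = Γ_φ` shows that `Γ_φ` is also Lefschetz"). [cite: Milne1999LefschetzClasses, §5 Thm. 5.10 (proof)] -/
theorem IsRiemannForm.of_cycleForm_graph_eq_sum (hη : IsRiemannForm Φ₂ η) {d : Fin g → ℕ}
    (hd : IsPolarizationType Φ₂ η d) (e : Fin (N₁ + 2 * g) ≃ ι₁ ⊕ ι₂) :
    of (2 * g) ((SubtorusFrame.graph Φ₁ Φ₂ e₁ he₁ L A hA).cycleForm e) =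
      ∑ i ∈ Finset.range (2 * g + 1), ((-1 : ℂ) ^ i / ∏ k, (d k : ℂ)) •
          ∑ j ∈ Finset.Icc (i - g) (i / 2),
            ((Nat.factorial j * Nat.factorial (g + j - i) * Nat.factorial (i - 2 * j) : ℕ) : ℂ)⁻¹ •
              ((of 2 ((ofRealForm (-η)).compContinuousLinearMap
                    ((L.restrictScalars ℝ).comp (ContinuousLinearMap.fst ℝ E₁ E₂))) : GForm (E₁ × E₂) ℂ) ^ (g + j - i) *
                  of 2 ((ofRealForm (-η)).compContinuousLinearMap (ContinuousLinearMap.snd ℝ E₁ E₂)) ^ j *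
                  of 2 (((ofRealForm (-η)).compContinuousLinearMap
                      ((L.restrictScalars ℝ).comp (ContinuousLinearMap.fst ℝ E₁ E₂) + ContinuousLinearMap.snd ℝ E₁ E₂)) -
                    ((ofRealForm (-η)).compContinuousLinearMap
                      ((L.restrictScalars ℝ).comp (ContinuousLinearMap.fst ℝ E₁ E₂))) -
                    ((ofRealForm (-η)).compContinuousLinearMap (ContinuousLinearMap.snd ℝ E₁ E₂))) ^ (i - 2 * j)) := by
  obtain ⟨e₀, he₀⟩ := exists_orientationSign_eq_one Φ₂ e₂
  have e' : Fin (2 * g + 2 * g) ≃ ι₂ ⊕ ι₂ := finSumFinEquiv.symm.trans (e₀.sumCongr e₀)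
  set ρ : E₁ × E₂ →L[ℝ] E₂ × E₂ :=
    realRep (prodPeriod Φ₁ Φ₂) (prodPeriod Φ₂ Φ₂) (Matrix.fromBlocks A 0 0 (1 : Matrix ι₂ ι₂ ℤ)) with hρ
  have h1 : ((ofRealForm (-η)).compContinuousLinearMap (ContinuousLinearMap.fst ℝ E₂ E₂)).compContinuousLinearMap ρ =
      (ofRealForm (-η)).compContinuousLinearMap ((L.restrictScalars ℝ).comp (ContinuousLinearMap.fst ℝ E₁ E₂)) := by
    rw [compCLM_compCLM'', hρ, fst_comp_realRep_fromBlocks_one Φ₁ Φ₂ hA]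
  have h2 : ((ofRealForm (-η)).compContinuousLinearMap (ContinuousLinearMap.snd ℝ E₂ E₂)).compContinuousLinearMap ρ =
      (ofRealForm (-η)).compContinuousLinearMap (ContinuousLinearMap.snd ℝ E₁ E₂) := by
    rw [compCLM_compCLM'', hρ, snd_comp_realRep_fromBlocks_one Φ₁ Φ₂]
  have h3 : (((ofRealForm (-η)).compContinuousLinearMap (ContinuousLinearMap.fst ℝ E₂ E₂ +
        ContinuousLinearMap.snd ℝ E₂ E₂)) -
      ((ofRealForm (-η)).compContinuousLinearMap (ContinuousLinearMap.fst ℝ E₂ E₂)) -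
      ((ofRealForm (-η)).compContinuousLinearMap (ContinuousLinearMap.snd ℝ E₂ E₂))).compContinuousLinearMap ρ =
      ((ofRealForm (-η)).compContinuousLinearMap
          ((L.restrictScalars ℝ).comp (ContinuousLinearMap.fst ℝ E₁ E₂) + ContinuousLinearMap.snd ℝ E₁ E₂)) -
        ((ofRealForm (-η)).compContinuousLinearMap ((L.restrictScalars ℝ).comp (ContinuousLinearMap.fst ℝ E₁ E₂))) -
        ((ofRealForm (-η)).compContinuousLinearMap (ContinuousLinearMap.snd ℝ E₁ E₂)) := by
    rw [sub_sub_compCLM, compCLM_compCLM'', compCLM_compCLM'', compCLM_compCLM'', hρ,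
      fst_add_snd_comp_realRep_fromBlocks_one Φ₁ Φ₂ hA, fst_comp_realRep_fromBlocks_one Φ₁ Φ₂ hA,
      snd_comp_realRep_fromBlocks_one Φ₁ Φ₂]
  rw [SubtorusFrame.cycleForm_graph_eq_cycleForm_diagonal_comp_realRep Φ₁ Φ₂ e₁ he₁ e₀ he₀ hA e e', ← hρ,
    ← GForm.pullG_of, ← hη.sum_schollProjector_eq_of_cycleForm_diagonal Φ₂ e₀ he₀ e' hd, map_sum]
  refine Finset.sum_congr rfl fun i _ ↦ ?_
  rw [GForm.pullG_smul_complex, map_sum]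
  congr 1
  refine Finset.sum_congr rfl fun j _ ↦ ?_
  rw [GForm.pullG_smul_complex, pullG_mul, pullG_mul, pullG_pow, pullG_pow, pullG_pow, GForm.pullG_of, GForm.pullG_of,
    GForm.pullG_of, h1, h2, h3]

end GraphFormula

end ComplexTorus

end Literature.Geometry.Kaehler
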